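import Mathlib.RingTheory.MvPolynomial.Ideal
import Mathlib.RingTheory.Ideal.Maps
import Mathlib.RingTheory.Ideal.Prime
import Mathlib.RingTheory.Ideal.Quotient.Nilpotent
import HarnessLib

/-!
# The ideal of the variables `𝔪₀ = (X_i : i ∈ σ) ⊆ R[X_σ]` — basic membership kit

`Literature/RingTheory/MvPolynomial/IdealOfVarsBasics.lean` (HIRONAKA-L discharge lane, librarian res-D-lib-2,
dedupe hoist; DEF-FREE). Mathlib's `MvPolynomial.idealOfVars σ R = Ideal.span (range X)` (the maximal ideal of the
origin of `𝔸^σ` when `R` is a field) comes with `mem_pow_idealOfVars_iff(')`, `monomial_mem_pow_idealOfVars_iff`,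
`C_mem_pow_idealOfVars_iff`, `pow_idealOfVars_eq_span`. The resolution programme's specimen / bed files over
`Fin 3`, `Fin 4`, `Fin 5` variables re-derived privately, per arity, the same one-liners (librarian census
2026-08-27T14:0xZ: `X_mem(_idealOfVars)` ×8 files in the last hour alone, `X_pow_mem_idealOfVars_pow_iff` ×7,
`collapse_idealOfVars_le` ×5, `X_pow_mem`, `mul_mem_pow_add`, …). Stated ONCE here, for an arbitrary index type
`σ` and (semi)ring `R`:

* `X_mem_idealOfVars`, `X_pow_mem_idealOfVars_pow`, `X_mul_X_mem_idealOfVars_sq`,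
  `X_pow_mem_idealOfVars_pow_iff` (`X_i^e ∈ 𝔪₀ⁿ ↔ n ≤ e`, nontrivial `R`), `X_notMem_idealOfVars_pow`,
  `monomial_mem_idealOfVars_pow_of_le`, `sum_C_mul_X_mem_idealOfVars`;
* `mem_idealOfVars_iff_constantCoeff_eq_zero`, `idealOfVars_eq_ker_constantCoeff`, `C_mem_idealOfVars_iff`,
  `idealOfVars_ne_top`, `isPrime_idealOfVars` (`R` a domain);
* substitutions: `map_aeval_idealOfVars_le` — for `f : σ → R[X_τ]` with `constantCoeff (f i) = 0` (e.g. each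
  variable sent to a variable or to `0`, the «collapse» of the bed files), `aeval f` maps `𝔪₀` into `𝔪₀`; hence
  `aeval_mem_idealOfVars_pow` (`𝔪₀ⁿ ↦ 𝔪₀ⁿ`).

Over a FIELD the tree already has (not restated): `Literature.AlgebraicGeometry.Hironaka2017.Lib.CuspChartRing`'s
`CuspChart.X_mem_idealOfVars`, `CuspChart.ker_constantCoeff_eq_idealOfVars`, `CuspChart.isMaximal_idealOfVars`,
`CuspChart.exists_mul_mem_pow_of_algebraMap_mem_maximalIdeal_pow` (orders at the origin via `K[X]_{𝔪₀}`), and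
`Literature.AlgebraicGeometry.Resolution`'s `mem_idealOfVars_of_constantCoeff_eq_zero`,
`mem_pow_idealOfVars_of_isHomogeneous`, `homogeneousComponent_eq_zero_of_mem_pow_idealOfVars`,
`idealOfVars_map_translate` (translation to a rational point). [cite: AtiyahMacdonald1969, Ch. 1 Ex. 1.1 / Ch. 7 (the ideal (x₁,…,xₙ) of k[x₁,…,xₙ])]
-/

open MvPolynomial

open scoped BigOperators

namespace Literature.RingTheory.MvPolynomial

variable {σ : Type*} {R : Type*}

section Semiring

variable [CommSemiring R]

/-- `X_i ∈ 𝔪₀ = (X_j : j)`. [cite: AtiyahMacdonald1969, Ch. 1 Ex. 1.1 (the ideal (x₁,…,xₙ))] -/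
theorem X_mem_idealOfVars (i : σ) : (X i : MvPolynomial σ R) ∈ MvPolynomial.idealOfVars σ R :=
  Ideal.subset_span (Set.mem_range_self i)

/-- `X_i^n ∈ 𝔪₀ⁿ`. [cite: AtiyahMacdonald1969, Ch. 1 Ex. 1.1 (the ideal (x₁,…,xₙ))] -/
theorem X_pow_mem_idealOfVars_pow (i : σ) (n : ℕ) :
    (X i : MvPolynomial σ R) ^ n ∈ MvPolynomial.idealOfVars σ R ^ n :=
  Ideal.pow_mem_pow (X_mem_idealOfVars i) n

/-- `X_i X_j ∈ 𝔪₀²`. [cite: AtiyahMacdonald1969, Ch. 1 Ex. 1.1 (the ideal (x₁,…,xₙ))] -/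
theorem X_mul_X_mem_idealOfVars_sq (i j : σ) :
    (X i * X j : MvPolynomial σ R) ∈ MvPolynomial.idealOfVars σ R ^ 2 := by
  rw [pow_two]
  exact Ideal.mul_mem_mul (X_mem_idealOfVars i) (X_mem_idealOfVars j)

/-- A monomial of degree `≥ n` lies in `𝔪₀ⁿ` (any coefficient; Mathlib's `monomial_mem_pow_idealOfVars_iff` is the
`iff` for a non-zero coefficient). [cite: AtiyahMacdonald1969, Ch. 1 Ex. 1.1 (the ideal (x₁,…,xₙ))] -/
theorem monomial_mem_idealOfVars_pow_of_le {n : ℕ} {d : σ →₀ ℕ} (h : n ≤ d.degree) (c : R) :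
    monomial d c ∈ MvPolynomial.idealOfVars σ R ^ n := by
  classical
  by_cases hc : c = 0
  · rw [hc, map_zero]; exact zero_mem _
  · exact (MvPolynomial.monomial_mem_pow_idealOfVars_iff n d hc).mpr h

/-- **`X_i^e ∈ 𝔪₀ⁿ ↔ n ≤ e`** (nontrivial coefficients). [cite: AtiyahMacdonald1969, Ch. 1 Ex. 1.1 (the ideal (x₁,…,xₙ))] -/
theorem X_pow_mem_idealOfVars_pow_iff [Nontrivial R] (i : σ) (e n : ℕ) :
    (X i : MvPolynomial σ R) ^ e ∈ MvPolynomial.idealOfVars σ R ^ n ↔ n ≤ e := by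
  rw [X_pow_eq_monomial, MvPolynomial.monomial_mem_pow_idealOfVars_iff n _ (one_ne_zero' R),
    Finsupp.degree_single]

/-- `X_i^e ∉ 𝔪₀ⁿ` for `e < n` (nontrivial coefficients); e.g. `X_i ∉ 𝔪₀²`.
[cite: AtiyahMacdonald1969, Ch. 1 Ex. 1.1 (the ideal (x₁,…,xₙ))] -/
theorem X_pow_notMem_idealOfVars_pow [Nontrivial R] (i : σ) {e n : ℕ} (h : e < n) :
    (X i : MvPolynomial σ R) ^ e ∉ MvPolynomial.idealOfVars σ R ^ n := by
  rw [X_pow_mem_idealOfVars_pow_iff]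
  exact Nat.not_le.mpr h

/-- `X_i ∉ 𝔪₀²` (nontrivial coefficients). [cite: AtiyahMacdonald1969, Ch. 1 Ex. 1.1 (the ideal (x₁,…,xₙ))] -/
theorem X_notMem_idealOfVars_sq [Nontrivial R] (i : σ) :
    (X i : MvPolynomial σ R) ∉ MvPolynomial.idealOfVars σ R ^ 2 := by
  simpa using X_pow_notMem_idealOfVars_pow (R := R) i (show 1 < 2 by norm_num)

/-- A linear combination `Σ_{i∈s} C(c_i) X_i` lies in `𝔪₀`. [cite: AtiyahMacdonald1969, Ch. 1 Ex. 1.1 (the ideal (x₁,…,xₙ))] -/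
theorem sum_C_mul_X_mem_idealOfVars (s : Finset σ) (c : σ → R) :
    ∑ i ∈ s, C (c i) * (X i : MvPolynomial σ R) ∈ MvPolynomial.idealOfVars σ R :=
  Ideal.sum_mem _ fun i _ => Ideal.mul_mem_left _ _ (X_mem_idealOfVars i)

/-- **`f ∈ 𝔪₀ ↔ constantCoeff f = 0`.** [cite: AtiyahMacdonald1969, Ch. 1 Ex. 1.1 (the ideal (x₁,…,xₙ))] -/
theorem mem_idealOfVars_iff_constantCoeff_eq_zero (f : MvPolynomial σ R) :
    f ∈ MvPolynomial.idealOfVars σ R ↔ constantCoeff f = 0 := by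
  rw [← pow_one (MvPolynomial.idealOfVars σ R), MvPolynomial.mem_pow_idealOfVars_iff']
  constructor
  · intro h
    exact h 0 (by simp)
  · intro h x hx
    rw [Nat.lt_one_iff, Finsupp.degree_eq_zero_iff] at hx
    subst hx
    exact h

/-- `𝔪₀ = ker (constantCoeff)` (semiring form; the `CommRing`/field form is
`CuspChart.ker_constantCoeff_eq_idealOfVars`). [cite: AtiyahMacdonald1969, Ch. 1 Ex. 1.1 (the ideal (x₁,…,xₙ))] -/
theorem idealOfVars_eq_ker_constantCoeff :
    MvPolynomial.idealOfVars σ R = RingHom.ker (constantCoeff : MvPolynomial σ R →+* R) := by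
  ext f
  rw [mem_idealOfVars_iff_constantCoeff_eq_zero, RingHom.mem_ker]

/-- `C c ∈ 𝔪₀ ↔ c = 0`. [cite: AtiyahMacdonald1969, Ch. 1 Ex. 1.1 (the ideal (x₁,…,xₙ))] -/
theorem C_mem_idealOfVars_iff (c : R) : (C c : MvPolynomial σ R) ∈ MvPolynomial.idealOfVars σ R ↔ c = 0 := by
  rw [mem_idealOfVars_iff_constantCoeff_eq_zero, constantCoeff_C]

/-- `𝔪₀ ≠ ⊤` (nontrivial coefficients). [cite: AtiyahMacdonald1969, Ch. 1 Ex. 1.1 (the ideal (x₁,…,xₙ))] -/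
theorem idealOfVars_ne_top [Nontrivial R] : MvPolynomial.idealOfVars σ R ≠ ⊤ := by
  intro h
  have h1 : (1 : MvPolynomial σ R) ∈ MvPolynomial.idealOfVars σ R := h ▸ Submodule.mem_top
  rw [mem_idealOfVars_iff_constantCoeff_eq_zero, map_one] at h1
  exact one_ne_zero h1

/-! ## Substitutions with vanishing constant terms preserve `𝔪₀` -/

/-- **Substitutions `X_i ↦ f_i` with `f_i(0) = 0` map `𝔪₀` into `𝔪₀`** (e.g. each variable sent to a variable or
to `0` — the «collapse» substitutions of the coordinate-subspace computations).
[cite: AtiyahMacdonald1969, Ch. 1 Ex. 1.1 (the ideal (x₁,…,xₙ)); (1.17) extension of ideals] -/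
theorem map_aeval_idealOfVars_le {τ : Type*} (f : σ → MvPolynomial τ R) (hf : ∀ i, constantCoeff (f i) = 0) :
    (MvPolynomial.idealOfVars σ R).map (aeval f) ≤ MvPolynomial.idealOfVars τ R := by
  rw [MvPolynomial.idealOfVars, Ideal.map_span, Ideal.span_le]
  rintro _ ⟨_, ⟨i, rfl⟩, rfl⟩
  rw [aeval_X]
  exact (mem_idealOfVars_iff_constantCoeff_eq_zero _).mpr (hf i)

/-- Substitutions with vanishing constant terms map `𝔪₀ⁿ` into `𝔪₀ⁿ`.
[cite: AtiyahMacdonald1969, Ch. 1 Ex. 1.1 (the ideal (x₁,…,xₙ)); (1.17) extension of ideals] -/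
theorem aeval_mem_idealOfVars_pow {τ : Type*} (f : σ → MvPolynomial τ R) (hf : ∀ i, constantCoeff (f i) = 0)
    {n : ℕ} {p : MvPolynomial σ R} (hp : p ∈ MvPolynomial.idealOfVars σ R ^ n) :
    aeval f p ∈ MvPolynomial.idealOfVars τ R ^ n := by
  have h1 : aeval f p ∈ (MvPolynomial.idealOfVars σ R ^ n).map (aeval f) := Ideal.mem_map_of_mem _ hp
  rw [Ideal.map_pow] at h1
  exact Ideal.pow_right_mono (map_aeval_idealOfVars_le f hf) n h1

/-- The «collapse» substitution of the bed files: send the variables in `S` to `X_k` and the others to `0`; it maps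
`𝔪₀` into `𝔪₀`. [cite: AtiyahMacdonald1969, Ch. 1 Ex. 1.1 (the ideal (x₁,…,xₙ)); (1.17) extension of ideals] -/
theorem map_aeval_collapse_idealOfVars_le [DecidableEq σ] (k : σ) (S : Finset σ) :
    (MvPolynomial.idealOfVars σ R).map
        (aeval fun j : σ => if j ∈ S then (X k : MvPolynomial σ R) else 0) ≤ MvPolynomial.idealOfVars σ R :=
  map_aeval_idealOfVars_le _ fun j => by
    by_cases hj : j ∈ S
    · rw [if_pos hj, constantCoeff_X]
    · rw [if_neg hj, map_zero]

end Semiring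

section Ring

variable [CommRing R]

/-- `𝔪₀` is prime when `R` is a domain (`R[X]/𝔪₀ ≅ R`). [cite: AtiyahMacdonald1969, Ch. 1 Ex. 1.1 (the ideal (x₁,…,xₙ))] -/
theorem isPrime_idealOfVars [IsDomain R] : (MvPolynomial.idealOfVars σ R).IsPrime := by
  rw [idealOfVars_eq_ker_constantCoeff]
  exact RingHom.ker_isPrime _

/-- `f - C (constantCoeff f) ∈ 𝔪₀`. [cite: AtiyahMacdonald1969, Ch. 1 Ex. 1.1 (the ideal (x₁,…,xₙ))] -/
theorem sub_C_constantCoeff_mem_idealOfVars (f : MvPolynomial σ R) :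
    f - C (constantCoeff f) ∈ MvPolynomial.idealOfVars σ R := by
  rw [mem_idealOfVars_iff_constantCoeff_eq_zero, map_sub, constantCoeff_C, sub_self]

end Ring

/-! ## §2 Units modulo `𝔪₀ⁿ` and the «collapse» non-membership test (librarian APPEND, res-D-lib-2 gen 10)

For ANY commutative ring `R`: `u ∈ R[X_σ]` is a unit modulo `𝔪₀ⁿ` (`n ≥ 1`) iff its constant term is a unit of `R`
(`R[X_σ]/𝔪₀ ≅ R` via `constantCoeff`, and units lift along the nilpotent thickening `R[X_σ]/𝔪₀ⁿ → R[X_σ]/𝔪₀`);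
hence such a `u` (e.g. `(X_i - 1)^k`, `1 + X_i X_j`) can be CANCELLED in membership questions `u q ∈ 𝔪₀ⁿ`.
Combined with `aeval_mem_idealOfVars_pow` this gives the residual-order test used by the explicit bed computations:
if a substitution with vanishing constant terms sends `q` to `C s · X_k^e` with `s` a unit and `e < n`, then
`q ∉ 𝔪₀ⁿ`. [cite: AtiyahMacdonald1969, Ch. 1 Ex. 1 p.10 («the sum of a nilpotent element and a unit is a unit») with Ch. 1 Ex. 1.1 (the ideal (x₁,…,xₙ))] -/

section UnitsModPowers

variable [CommRing R]

/-- `u` is a unit modulo `𝔪₀` iff its constant term is a unit (`R[X_σ]/𝔪₀ ≅ R`).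
[cite: AtiyahMacdonald1969, Ch. 1 Ex. 1.1 (the ideal (x₁,…,xₙ))] -/
theorem isUnit_mk_idealOfVars_iff (u : MvPolynomial σ R) :
    IsUnit (Ideal.Quotient.mk (MvPolynomial.idealOfVars σ R) u) ↔ IsUnit (constantCoeff u) := by
  have hker : MvPolynomial.idealOfVars σ R ≤ RingHom.ker (constantCoeff : MvPolynomial σ R →+* R) :=
    idealOfVars_eq_ker_constantCoeff.le
  have hmk : Ideal.Quotient.mk (MvPolynomial.idealOfVars σ R) u =
      Ideal.Quotient.mk (MvPolynomial.idealOfVars σ R) (C (constantCoeff u)) := by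
    rw [Ideal.Quotient.eq]
    exact sub_C_constantCoeff_mem_idealOfVars u
  constructor
  · intro h
    have h' := h.map (Ideal.Quotient.lift (MvPolynomial.idealOfVars σ R) constantCoeff fun a ha => hker ha)
    rwa [Ideal.Quotient.lift_mk] at h'
  · intro h
    rw [hmk]
    exact (h.map C).map _

/-- **`u` is a unit modulo `𝔪₀ⁿ` (`n ≠ 0`) iff its constant term is a unit.**
[cite: AtiyahMacdonald1969, Ch. 1 Ex. 1.1 (units + nilpotents; the ideal (x₁,…,xₙ))] -/
theorem isUnit_mk_idealOfVars_pow_iff {n : ℕ} (hn : n ≠ 0) (u : MvPolynomial σ R) :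
    IsUnit (Ideal.Quotient.mk (MvPolynomial.idealOfVars σ R ^ n) u) ↔ IsUnit (constantCoeff u) := by
  rw [Ideal.Quotient.isUnit_mk_pow_iff_isUnit_mk _ hn, isUnit_mk_idealOfVars_iff]

/-- A polynomial with unit constant term is a unit modulo every `𝔪₀ⁿ`.
[cite: AtiyahMacdonald1969, Ch. 1 Ex. 1.1 (units + nilpotents; the ideal (x₁,…,xₙ))] -/
theorem isUnit_mk_idealOfVars_pow_of_isUnit_constantCoeff {u : MvPolynomial σ R} (hu : IsUnit (constantCoeff u))
    (n : ℕ) : IsUnit (Ideal.Quotient.mk (MvPolynomial.idealOfVars σ R ^ n) u) := by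
  rcases Nat.eq_zero_or_pos n with rfl | hn
  · rw [pow_zero, Ideal.one_eq_top]
    exact isUnit_of_subsingleton _
  · exact (isUnit_mk_idealOfVars_pow_iff hn.ne' u).mpr hu

/-- **Cancellation of a factor with unit constant term:** `u q ∈ 𝔪₀ⁿ ↔ q ∈ 𝔪₀ⁿ`.
[cite: AtiyahMacdonald1969, Ch. 1 Ex. 1.1 (units + nilpotents; the ideal (x₁,…,xₙ))] -/
theorem mul_mem_idealOfVars_pow_iff_of_isUnit_constantCoeff {u : MvPolynomial σ R} (hu : IsUnit (constantCoeff u))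
    (q : MvPolynomial σ R) (n : ℕ) :
    u * q ∈ MvPolynomial.idealOfVars σ R ^ n ↔ q ∈ MvPolynomial.idealOfVars σ R ^ n := by
  rw [← Ideal.Quotient.eq_zero_iff_mem, ← Ideal.Quotient.eq_zero_iff_mem, map_mul]
  exact (isUnit_mk_idealOfVars_pow_of_isUnit_constantCoeff hu n).mul_right_eq_zero

/-- Cancellation on the right: `q u ∈ 𝔪₀ⁿ ↔ q ∈ 𝔪₀ⁿ` for `u` with unit constant term.
[cite: AtiyahMacdonald1969, Ch. 1 Ex. 1.1 (units + nilpotents; the ideal (x₁,…,xₙ))] -/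
theorem mul_mem_idealOfVars_pow_iff_of_isUnit_constantCoeff_right {u : MvPolynomial σ R}
    (hu : IsUnit (constantCoeff u)) (q : MvPolynomial σ R) (n : ℕ) :
    q * u ∈ MvPolynomial.idealOfVars σ R ^ n ↔ q ∈ MvPolynomial.idealOfVars σ R ^ n := by
  rw [mul_comm]
  exact mul_mem_idealOfVars_pow_iff_of_isUnit_constantCoeff hu q n

/-- `X_i - C c` has unit constant term when `c` is a unit; in particular `(X_i - C c)^k q ∈ 𝔪₀ⁿ ↔ q ∈ 𝔪₀ⁿ`.
[cite: AtiyahMacdonald1969, Ch. 1 Ex. 1.1 (units + nilpotents; the ideal (x₁,…,xₙ))] -/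
theorem X_sub_C_pow_mul_mem_idealOfVars_pow_iff (i : σ) {c : R} (hc : IsUnit c) (k : ℕ)
    (q : MvPolynomial σ R) (n : ℕ) :
    (X i - C c) ^ k * q ∈ MvPolynomial.idealOfVars σ R ^ n ↔ q ∈ MvPolynomial.idealOfVars σ R ^ n := by
  refine mul_mem_idealOfVars_pow_iff_of_isUnit_constantCoeff ?_ q n
  rw [map_pow, map_sub, constantCoeff_X, constantCoeff_C, zero_sub]
  exact (hc.neg).pow k

/-- Transport of NON-membership along a substitution with vanishing constant terms: if `aeval f q ∉ 𝔪₀ⁿ` then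
`q ∉ 𝔪₀ⁿ` (contrapositive of `aeval_mem_idealOfVars_pow`).
[cite: AtiyahMacdonald1969, Ch. 1 Ex. 1.1 (the ideal (x₁,…,xₙ)); (1.17) extension of ideals] -/
theorem notMem_idealOfVars_pow_of_aeval_notMem {τ : Type*} (f : σ → MvPolynomial τ R)
    (hf : ∀ i, constantCoeff (f i) = 0) {n : ℕ} {q : MvPolynomial σ R}
    (h : aeval f q ∉ MvPolynomial.idealOfVars τ R ^ n) : q ∉ MvPolynomial.idealOfVars σ R ^ n :=
  fun hq => h (aeval_mem_idealOfVars_pow f hf hq)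

/-- **The «collapse» non-membership test** of the explicit bed computations, any arity, any commutative ring with
`0 ≠ 1`: if a substitution `X_i ↦ f_i` with `f_i(0) = 0` sends `q` to `C s · X_k^e` with `s` a unit and `e < n`,
then `q ∉ 𝔪₀ⁿ`. [cite: AtiyahMacdonald1969, Ch. 1 Ex. 1.1 (the ideal (x₁,…,xₙ)); (1.17) extension of ideals] -/
theorem notMem_idealOfVars_pow_of_aeval_eq_C_mul_X_pow [Nontrivial R] {τ : Type*} (f : σ → MvPolynomial τ R)
    (hf : ∀ i, constantCoeff (f i) = 0) {n e : ℕ} (he : e < n) {s : R} (hs : IsUnit s) (k : τ)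
    {q : MvPolynomial σ R} (h : aeval f q = C s * X k ^ e) : q ∉ MvPolynomial.idealOfVars σ R ^ n := by
  refine notMem_idealOfVars_pow_of_aeval_notMem f hf fun hq => ?_
  rw [h, mul_mem_idealOfVars_pow_iff_of_isUnit_constantCoeff (by rwa [constantCoeff_C]),
    X_pow_mem_idealOfVars_pow_iff] at hq
  exact Nat.not_le.mpr he hq

end UnitsModPowers

/-! ## §3 Coefficient tests (librarian APPEND, res-D-lib-2 gen 10)

Mathlib's `mem_pow_idealOfVars_iff'` (`q ∈ 𝔪₀ⁿ ↔ ∀ d, |d| < n → coeff d q = 0`) in the three one-step forms the explicit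
computations use: a coefficient below degree `n` vanishes on `𝔪₀ⁿ`; ONE non-zero coefficient of degree `< n` — of `q`, or of
its image under a substitution with vanishing constant terms — certifies `q ∉ 𝔪₀ⁿ`.
[cite: AtiyahMacdonald1969, Ch. 1 Ex. 1.1 (the ideal (x₁,…,xₙ)); (1.17) extension of ideals] -/

section CoeffTests

variable [CommSemiring R]

/-- On `𝔪₀ⁿ` every coefficient of degree `< n` vanishes. [cite: AtiyahMacdonald1969, Ch. 1 Ex. 1.1 (the ideal (x₁,…,xₙ))] -/
theorem coeff_eq_zero_of_mem_idealOfVars_pow {q : MvPolynomial σ R} {n : ℕ} (h : q ∈ MvPolynomial.idealOfVars σ R ^ n)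
    {d : σ →₀ ℕ} (hd : d.degree < n) : coeff d q = 0 :=
  (MvPolynomial.mem_pow_idealOfVars_iff' n q).mp h d hd

/-- On `𝔪₀ⁿ`, `n ≠ 0`, the constant term vanishes. [cite: AtiyahMacdonald1969, Ch. 1 Ex. 1.1 (the ideal (x₁,…,xₙ))] -/
theorem constantCoeff_eq_zero_of_mem_idealOfVars_pow {q : MvPolynomial σ R} {n : ℕ}
    (h : q ∈ MvPolynomial.idealOfVars σ R ^ n) (hn : n ≠ 0) : constantCoeff q = 0 :=
  coeff_eq_zero_of_mem_idealOfVars_pow h (d := 0) (by rw [map_zero]; exact Nat.pos_of_ne_zero hn)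

/-- **One non-zero coefficient of degree `< n` certifies `q ∉ 𝔪₀ⁿ`.** [cite: AtiyahMacdonald1969, Ch. 1 Ex. 1.1 (the ideal (x₁,…,xₙ))] -/
theorem notMem_idealOfVars_pow_of_coeff_ne_zero {q : MvPolynomial σ R} {n : ℕ} {d : σ →₀ ℕ} (hd : d.degree < n)
    (h : coeff d q ≠ 0) : q ∉ MvPolynomial.idealOfVars σ R ^ n :=
  fun hq => h (coeff_eq_zero_of_mem_idealOfVars_pow hq hd)

/-- **The «collapse» test by one coefficient**: if a substitution `X_i ↦ f_i` with `f_i(0) = 0` sends `q` to a polynomial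
with a non-zero coefficient of degree `< n`, then `q ∉ 𝔪₀ⁿ` (any arity, any commutative semiring).
[cite: AtiyahMacdonald1969, Ch. 1 Ex. 1.1 (the ideal (x₁,…,xₙ)); (1.17) extension of ideals] -/
theorem notMem_idealOfVars_pow_of_coeff_aeval_ne_zero {τ : Type*} (f : σ → MvPolynomial τ R)
    (hf : ∀ i, constantCoeff (f i) = 0) {q : MvPolynomial σ R} {n : ℕ} {d : τ →₀ ℕ} (hd : d.degree < n)
    (h : coeff d (aeval f q) ≠ 0) : q ∉ MvPolynomial.idealOfVars σ R ^ n :=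
  fun hq => h (coeff_eq_zero_of_mem_idealOfVars_pow (aeval_mem_idealOfVars_pow f hf hq) hd)

end CoeffTests

end Literature.RingTheory.MvPolynomial
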